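import Literature.NumberTheory.Automorphic.Liu2021.NablaMapSurjectiveOfPieces
import Literature.AlgebraicGeometry.Morphisms.GeometricPointsLiftSurjective
import Mathlib.AlgebraicGeometry.Morphisms.Proper
import HarnessLib

/-!
# Liu 2021 §2.1 / §4.2 with Lang, *Abelian Varieties* II §3 Prop. 7: `∇u` hits every complex point of `∇X`, and `Alb_u` is an
# epimorphism, for EVERY surjective `u`

[Liu2021] = Yifeng Liu, *Fourier–Jacobi cycles and arithmetic relative trace formula*, Camb. J. Math. **9** (2021) =
arXiv:2102.11518 (`FJcycle.tex` line numbers as in `Liu2021/AppendixC/Glue.lean`).  PROOF FILE (theorems only; no definition,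
no named fact, no instance, no `sorry`) over the carriers `AppendixC.Nabla` (Def. 2.1 (1): «the smallest open and closed subscheme of
`X × X` containing the diagonal `ΔX`», with `∇u` the restriction of `u × u`, l. 1171–1176), `AppendixC.Albanese` (Def. 2.3) and the
§4.2 datum `AppendixC.Sec42Data` (fields `nablaTr`, `Atr`).  Sequel of ★ `Liu2021/NablaMapSurjectiveOfPieces`
(`Nabla.exists_comp_eq_of_pieces_lift`: every `ℂ`-point of `∇X` lifts along `∇u` AS SOON AS same-piece pairs of complex points lift
along `u`) and of ★ `Liu2021/AppendixC/AlbaneseTraceIsogeny` (`Nabla.surjective_map_left`: `∇u` is surjective for `u` surjective,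
universally closed AND UNIVERSALLY OPEN).  Here the universal openness (flatness) is dropped: the same-piece lifting holds for every
SURJECTIVE and universally closed `u` — the generality of [Lang1983AbelianVarieties] Ch. II §3 Prop. 7 («if `φ` is generically
surjective then `φ_*` is generically surjective», `φ_* : A(V) → A(W)` the induced homomorphism of Albanese varieties of Prop. 5) and of
Liu's transition morphisms `u^{K'}_K` (§4.2 l. 2064 «generically finite dominant»), with no flatness input.

## What is proved

Let `k ⊆ ℂ` (`[Algebra k ℂ]`), `u : Y → X` over `k`, `inj_c : P_c → X_ℂ` a colimit cofan of GEOMETRICALLY IRREDUCIBLE complex pieces and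
`inj'_{c'} : P'_{c'} → Y_ℂ` a colimit cofan of complex pieces.

* (§0, private twins of ★ `Morphisms.exists_comp_eq_of_mem_range` ∕ `exists_over_comp_eq_of_mem_range` of
  `Motives/JacobianBrillNoetherLocusPoints`, re-proved here to keep the Jacobian layer out of the `∇` imports) an `Ω`-point
  (`Ω` algebraically closed) of the target of a morphism LOCALLY OF FINITE TYPE whose underlying point is in the image lifts
  (the fibre is a non-empty Jacobson scheme, a closed point of it is an `Ω`-point; [GortzWedhorn2020] Cor. 3.36 / Prop. 4.8).
* `Nabla.pieces_lift_of_surjective` — **for `u` SURJECTIVE and UNIVERSALLY CLOSED (and `Y` locally of finite type), same-piece pairs of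
  complex points of `X` lift along `u` to same-piece pairs of complex points of `Y`.**  Proof: `u_ℂ` is surjective and closed (base
  change, [GortzWedhorn2020] Prop. 4.32); the generic point `η` of the irreducible piece `P_c` is `u_ℂ(y)` with `y` in some piece
  `P'_{c'}`; the closed set `u_ℂ(P'_{c'})` contains `η`, hence the closure `P_c` of `η`; so BOTH points of a pair in `P_c` lie under
  `P'_{c'}`, and they lift to `ℂ`-points of `P'_{c'}` by the Nullstellensatz (first bullet).
* `Nabla.exists_comp_eq_of_surjective` — hence, for `X` smooth of relative dimension `d` and projective and ANY carriers `∇X`, `∇Y`,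
  `ν : ∇Y → ∇X` over `u × u`: **every `ℂ`-point of `∇X` lifts along `ν`** (★ `Nabla.exists_comp_eq_of_pieces_lift`);
  `Nabla.exists_comp_eq_of_surjective_of_isProjectiveOver` — the same with `Y` projective instead of «`u` universally closed, `Y`
  locally of finite type» (a morphism between proper `k`-schemes is universally closed).
* `Albanese.epi_map_of_surjective_of_pieces` — **`Alb_u : Alb_Y → Alb_X` is an EPIMORPHISM of abelian varieties for every surjective
  `u : Y → X` of projective `k`-schemes with `X` smooth** (given the complex pieces): ★ `Albanese.epi_map_of_nablaMap_surjective_algPoints`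
  with `∇X` reduced and locally of finite type (★ `NablaSmooth`).  This is [Lang1983AbelianVarieties] II §3 Prop. 7 (surjective half) in
  Liu's `∇`-normalisation, for reducible `X`, `Y`.
* `Sec42Data.epi_Atr_of_surjective` — for a §4.2 datum `C` and `f : K' ⟶ K`: **`Alb_{u^{K'}_K} = C.Atr f` is an epimorphism as soon as
  `u^{K'}_K` is SURJECTIVE** (both levels are smooth projective, §4.2 l. 2064; given the complex pieces of both levels) — the flatness-free
  form of the input (I) «`AlbTransitionEpi`» of the reduction of [Liu2021, Thm. 4.18 (1)] (cell hodgecm-mathlib row VI-3, generic half).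

The PIECES-FREE forms (complex pieces produced for smooth projective `X`, `Y`; `Alb_u` epi for every surjective morphism of smooth
projective `k`-schemes; `Alb_{u^{K'}_K}` epi for every surjective transition of a §4.2 datum) are in the sequel
`Liu2021/AlbaneseMapEpiOfSurjective`.  HC_CM is proved only modulo the 7 printed citations until rung 0 closes; nothing here discharges a
COR-CM binder.  Ours (formalisation glue); axioms `propext`, `Classical.choice`, `Quot.sound`.

## References
* [Lang1983AbelianVarieties] S. Lang, *Abelian Varieties* (Interscience 1959; Springer 1983 reprint), Ch. II §3 «The Albanese variety»,
  Prop. 5 (p. 47: induced homomorphism `φ_*`) and Prop. 7 (p. 48: `φ` generically surjective ⇒ `φ_*` generically surjective).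
* [Liu2021] Y. Liu, arXiv:2102.11518 = Camb. J. Math. 9 (2021): §2.1 Def. 2.1 (1) (l. 1171–1176), proof of the Proposition
  (l. 1194–1200), Def. 2.3 (l. 1202–1208), §4.2 l. 2060–2072, proof of Thm. 4.18 (1) (l. 2247–2282).
* [GortzWedhorn2020] U. Görtz, T. Wedhorn, *Algebraic Geometry I*, 2nd ed. (2020): Cor. 3.36 (p. 83), Prop. 4.8 (p. 98) (points over
  algebraically closed fields), §(3.5) Example 3.11 (p. 73) (coproducts), Prop. 4.16 and Prop. 4.32 (base change), Prop. 3.25 / §(3.7)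
  (generic points of irreducible closed subsets).
-/

set_option autoImplicit false

noncomputable section

open CategoryTheory CategoryTheory.Limits AlgebraicGeometry MonoidalCategory CartesianMonoidalCategory
open Literature.AlgebraicGeometry.Motives

universe u

namespace Literature.NumberTheory.Automorphic.Liu2021.AppendixC

namespace Nabla

open AbelianVariety (bcSpec bcFunctor)

/-! ## §0 Points over algebraically closed fields lift along morphisms locally of finite type, pointwise (private twins) -/

/-- An `Ω`-point of `Y` whose underlying point lies in the image of `f : X → Y` lifts along `f`, for `f` locally of finite type and `Ω`
algebraically closed (the fibre `X ×_Y Spec Ω` is a non-empty Jacobson scheme; a closed point of it is an `Ω`-point).  PRIVATE TWIN of ★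
`Morphisms.exists_comp_eq_of_mem_range` (`Motives/JacobianBrillNoetherLocusPoints`), kept private here to avoid a Jacobian import into the
`∇` layer. [cite: GortzWedhorn2020, Cor. 3.36 (p. 83) and Prop. 4.8 (p. 98)] -/
private theorem exists_specHom_comp_eq_of_mem_range {X Y : Scheme.{u}} (f : X ⟶ Y) [LocallyOfFiniteType f]
    {Ω : Type u} [Field Ω] [IsAlgClosed Ω] (y : Spec (.of Ω) ⟶ Y)
    (hy : y (IsLocalRing.closedPoint Ω) ∈ Set.range f) :
    ∃ x : Spec (.of Ω) ⟶ X, x ≫ f = y := by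
  obtain ⟨x₀, hx₀⟩ := hy
  let g : pullback f y ⟶ Spec (.of Ω) := pullback.snd f y
  haveI : JacobsonSpace ↑(pullback f y) := LocallyOfFiniteType.jacobsonSpace g
  -- the fibre over `y` is non-empty: a point of `X ×_Y Spec Ω` above `(x₀, closed point)`
  obtain ⟨z, -, -⟩ := Scheme.Pullback.exists_preimage_pullback (f := f) (g := y) x₀ (IsLocalRing.closedPoint Ω) hx₀
  -- a closed point of the Jacobson scheme `X ×_Y Spec Ω`
  obtain ⟨a, -, hac⟩ := nonempty_inter_closedPoints (Z := (Set.univ : Set ↑(pullback f y))) ⟨z, trivial⟩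
    isClosed_univ.isLocallyClosed
  -- … is an `Ω`-point over `Spec Ω`
  refine ⟨pointOfClosedPoint g a (mem_closedPoints_iff.mp hac) ≫ pullback.fst f y, ?_⟩
  rw [Category.assoc, pullback.condition, ← Category.assoc, pointOfClosedPoint_comp, Category.id_comp]

/-- An `L`-point of a `K`-scheme `Z` whose underlying point lies in the image of a `K`-morphism `g : W → Z` locally of finite type
lifts along `g` (`L ⊇ K` algebraically closed): the `AlgPoints` reading of the previous lemma (compare ★ `AlgPoints.exists_comp_eq_of_pt_mem_range`
for open immersions, ★ `AlgPoints.map_surjective_of_surjective_of_isAlgClosed` for surjective `g`, ★ `Morphisms.exists_over_comp_eq_of_mem_range`).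
Private twin, see above. [cite: GortzWedhorn2020, Cor. 3.36 (p. 83) and Prop. 4.8 (p. 98)] -/
private theorem exists_algPoints_comp_eq_of_pt_mem_range {K : Type u} [Field K] {L : Type u} [Field L]
    [Algebra K L] [IsAlgClosed L] {W Z : SchemeOver K} (g : W ⟶ Z) [LocallyOfFiniteType g.left] (P : AlgPoints Z L)
    (h : P.pt ∈ Set.range ⇑g.left) : ∃ Q : AlgPoints W L, Q ≫ g = P := by
  obtain ⟨x, hx⟩ := exists_specHom_comp_eq_of_mem_range g.left P.left h
  have hQ : x ≫ W.hom = (specOver K L).hom := by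
    rw [← Over.w g, ← Category.assoc, hx]
    exact Over.w P
  exact ⟨Over.homMk x hQ, Over.OverMorphism.ext hx⟩


set_option backward.isDefEq.respectTransparency false

section Complex

variable {k : Type} [Field k] [Algebra k ℂ]

/-! ## §1 Same-piece pairs lift along a surjective, universally closed `u` -/

/-- **Same-piece pairs of complex points lift along every SURJECTIVE, universally closed morphism.**  Data: `u : Y → X` over `k ⊆ ℂ`
with `u` surjective and universally closed and `Y` locally of finite type over `k`; a family `inj_c : P_c → X_ℂ` of GEOMETRICALLY
IRREDUCIBLE complex schemes and a colimit cofan `inj'_{c'} : P'_{c'} → Y_ℂ`.  CONCLUSION (the hypothesis `hlift` of ★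
`Nabla.exists_comp_eq_of_pieces_lift`): any two complex points of one `P_c` are the images under `u_ℂ` of two complex points of ONE
`P'_{c'}`.  Proof: `u_ℂ` is surjective and closed (base change); the generic point of the irreducible `P_c` is `u_ℂ(y)` with `y` in some
piece `P'_{c'}` (the cofan covers `Y_ℂ`); `u_ℂ(P'_{c'})` is closed (the legs of a cofan have closed images) and contains the generic point,
hence all of `P_c`; complex points then lift by the Nullstellensatz (§0).  This is the set-theoretic heart of [Lang1983AbelianVarieties]
II §3 Prop. 7 («`φ` generically surjective ⇒ `φ_*` generically surjective») read for reducible `X`, `Y` through Liu's `∇`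
(Def. 2.1 (1)). [cite: Lang1983AbelianVarieties, Ch. II §3 Prop. 7 (p. 48)] [cite: Liu2021, §2.1 Def. 2.1 (1) (l. 1171–1176) and §4.2 l. 2064]
[cite: GortzWedhorn2020, Prop. 4.32, §(3.5) Example 3.11 (p. 73), Cor. 3.36 (p. 83)] -/
theorem pieces_lift_of_surjective {X Y : SchemeOver k} (u : Y ⟶ X) [Surjective u.left] [UniversallyClosed u.left]
    [LocallyOfFiniteType Y.hom]
    {κ κ' : Type} {P : κ → SchemeOver ℂ} {P' : κ' → SchemeOver ℂ}
    (inj : ∀ c, P c ⟶ (bcFunctor k ℂ).obj X) [∀ c, GeometricallyIrreducible (P c).hom]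
    (inj' : ∀ c', P' c' ⟶ (bcFunctor k ℂ).obj Y) (hcol' : IsColimit (Cofan.mk ((bcFunctor k ℂ).obj Y) inj')) :
    ∀ (c : κ) (z₁ z₂ : ComplexPoints (P c)), ∃ (c' : κ') (z₁' z₂' : ComplexPoints (P' c')),
      AlgPoints.map (inj' c' ≫ (bcFunctor k ℂ).map u) z₁' = AlgPoints.map (inj c) z₁ ∧
        AlgPoints.map (inj' c' ≫ (bcFunctor k ℂ).map u) z₂' = AlgPoints.map (inj c) z₂ := by
  intro c z₁ z₂
  -- `u_ℂ` is surjective and universally closed (base change of `u`)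
  haveI : Surjective ((bcFunctor k ℂ).map u).left :=
    MorphismProperty.of_isPullback (P := @Surjective) (GaloisDescent.isPullback_bcFunctor_map_left ℂ u).flip ‹_›
  haveI : UniversallyClosed ((bcFunctor k ℂ).map u).left :=
    MorphismProperty.of_isPullback (P := @UniversallyClosed) (GaloisDescent.isPullback_bcFunctor_map_left ℂ u).flip ‹_›
  haveI : IrreducibleSpace ↥(P c).left := GeometricallyIrreducible.irreducibleSpace_of_subsingleton (P c).hom
  -- the composite `P'_{c'} → Y_ℂ → X_ℂ` as a function
  have hfun : ∀ c', ⇑(inj' c' ≫ (bcFunctor k ℂ).map u).left = ⇑((bcFunctor k ℂ).map u).left ∘ ⇑(inj' c').left := fun c' => by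
    funext x
    rw [Over.comp_left, Scheme.Hom.comp_apply]
    rfl
  -- §A  the piece `P_c` lies under ONE piece `P'_{c'}`
  obtain ⟨c', hc'⟩ : ∃ c', Set.range ⇑(inj c).left ⊆ Set.range ⇑(inj' c' ≫ (bcFunctor k ℂ).map u).left := by
    obtain ⟨y, hy⟩ := ((bcFunctor k ℂ).map u).left.surjective ((inj c).left (genericPoint ↥(P c).left))
    obtain ⟨c', y', hy'⟩ := exists_eq_left_of_isColimit hcol' y
    refine ⟨c', ?_⟩
    -- `u_ℂ(P'_{c'})` is closed …
    have hR : IsClosed (Set.range ⇑(inj' c' ≫ (bcFunctor k ℂ).map u).left) := by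
      rw [hfun c', Set.range_comp]
      exact ((bcFunctor k ℂ).map u).left.isClosedMap _ (isClopen_range_left_of_isColimit hcol' c').1
    -- … and contains the generic point of `P_c`, hence all of `P_c`
    have hη : genericPoint ↥(P c).left ∈ ⇑(inj c).left ⁻¹' Set.range ⇑(inj' c' ≫ (bcFunctor k ℂ).map u).left := by
      refine ⟨y', ?_⟩
      rw [Over.comp_left, Scheme.Hom.comp_apply, hy', hy]
    have huniv := ((genericPoint_spec ↥(P c).left).mem_closed_set_iff
      (hR.preimage (Scheme.Hom.continuous (inj c).left))).mp hη
    rintro _ ⟨x, rfl⟩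
    exact huniv (Set.mem_univ x)
  -- §B  `P'_{c'} → X_ℂ` is locally of finite type
  haveI : LocallyOfFiniteType ((bcFunctor k ℂ).obj Y).hom := by
    change LocallyOfFiniteType (pullback.snd Y.hom (bcSpec k ℂ))
    infer_instance
  haveI : IsOpenImmersion (inj' c').left := isOpenImmersion_left_of_isColimit hcol' c'
  haveI : LocallyOfFiniteType (P' c').hom := by
    rw [← Over.w (inj' c')]
    infer_instance
  haveI : LocallyOfFiniteType (inj' c' ≫ (bcFunctor k ℂ).map u).left := by
    haveI : LocallyOfFiniteType ((inj' c' ≫ (bcFunctor k ℂ).map u).left ≫ ((bcFunctor k ℂ).obj X).hom) := by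
      rw [Over.w (inj' c' ≫ (bcFunctor k ℂ).map u)]
      infer_instance
    exact locallyOfFiniteType_of_comp _ ((bcFunctor k ℂ).obj X).hom
  -- §C  lift the two complex points (Nullstellensatz)
  obtain ⟨z₁', hz₁'⟩ := exists_algPoints_comp_eq_of_pt_mem_range
    (inj' c' ≫ (bcFunctor k ℂ).map u) (AlgPoints.map (inj c) z₁) (by rw [AlgPoints.pt_map]; exact hc' ⟨z₁.pt, rfl⟩)
  obtain ⟨z₂', hz₂'⟩ := exists_algPoints_comp_eq_of_pt_mem_range
    (inj' c' ≫ (bcFunctor k ℂ).map u) (AlgPoints.map (inj c) z₂) (by rw [AlgPoints.pt_map]; exact hc' ⟨z₂.pt, rfl⟩)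
  exact ⟨c', z₁', z₂', by rw [AlgPoints.map_apply]; exact hz₁', by rw [AlgPoints.map_apply]; exact hz₂'⟩

/-! ## §2 `∇u` hits every `ℂ`-point of `∇X` for `u` surjective -/

/-- **Every `ℂ`-point of `∇X` lifts along `∇u` for `u` SURJECTIVE** (no flatness): `k` of characteristic zero with `[Algebra k ℂ]`;
`u : Y → X` over `k`, surjective and universally closed, with `X` smooth of relative dimension `d` and projective and `Y` locally of finite
type; ANY carriers `N = ∇X`, `N' = ∇Y` and `ν : ∇Y → ∇X` with `ν ≫ (∇X ↪ X × X) = (∇Y ↪ Y × Y) ≫ (u × u)` (Def. 2.1 (1), l. 1176); colimit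
cofans of complex pieces `inj_c : P_c → X_ℂ` (geometrically irreducible) and `inj'_{c'} : P'_{c'} → Y_ℂ` (geometrically irreducible).
CONCLUSION: every `Pt : Spec ℂ → ∇X` over `k` factors as `Q ≫ ν`.  Assembly of §1 with ★ `Nabla.exists_comp_eq_of_pieces_lift`; compare ★
`Nabla.surjective_map_left` (which needs `u` universally open).  The `∇`-form of [Lang1983AbelianVarieties] II §3 Prop. 7 for Liu's
«generically finite dominant» transitions (§4.2 l. 2064). [cite: Liu2021, §2.1 Def. 2.1 (1) (l. 1171–1176), proof of the Proposition (l. 1194–1200), §4.2 l. 2060–2072]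
[cite: Lang1983AbelianVarieties, Ch. II §3 Prop. 7 (p. 48)] [cite: GortzWedhorn2020, Prop. 4.16 and Prop. 4.32] -/
theorem exists_comp_eq_of_surjective [CharZero k] {d : ℕ} {X Y : SchemeOver k} [SmoothOfRelativeDimension d X.hom]
    (hX : IsProjectiveOver X) (N : Nabla X) (N' : Nabla Y) (u : Y ⟶ X) [Surjective u.left] [UniversallyClosed u.left]
    [LocallyOfFiniteType Y.hom] (ν : N'.N ⟶ N.N) (hν : ν ≫ N.incl = N'.incl ≫ (u ⊗ₘ u))
    {κ κ' : Type} {P : κ → SchemeOver ℂ} {P' : κ' → SchemeOver ℂ}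
    (inj : ∀ c, P c ⟶ (bcFunctor k ℂ).obj X) [∀ c, GeometricallyIrreducible (P c).hom]
    (hcol : IsColimit (Cofan.mk ((bcFunctor k ℂ).obj X) inj))
    (inj' : ∀ c', P' c' ⟶ (bcFunctor k ℂ).obj Y) [∀ c', GeometricallyIrreducible (P' c').hom]
    (hcol' : IsColimit (Cofan.mk ((bcFunctor k ℂ).obj Y) inj')) :
    ∀ Pt : AlgPoints N.N ℂ, ∃ Q : AlgPoints N'.N ℂ, Q ≫ ν = Pt :=
  exists_comp_eq_of_pieces_lift (d := d) hX N N' u ν hν inj hcol inj' (pieces_lift_of_surjective u inj inj' hcol')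

/-- **The same for `Y` PROJECTIVE** (instead of «`u` universally closed, `Y` locally of finite type»): a `k`-morphism from a proper
`k`-scheme to a separated one is universally closed (Mathlib `UniversallyClosed.of_comp_of_isSeparated`), and a proper `Y` is locally of
finite type. [cite: Liu2021, §2.1 Def. 2.1 (1) (l. 1171–1176) and §4.2 l. 2060–2072] [cite: Lang1983AbelianVarieties, Ch. II §3 Prop. 7 (p. 48)]
[cite: GortzWedhorn2020, Prop. 4.16 and Prop. 4.32] -/
theorem exists_comp_eq_of_surjective_of_isProjectiveOver [CharZero k] {d : ℕ} {X Y : SchemeOver k}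
    [SmoothOfRelativeDimension d X.hom] (hX : IsProjectiveOver X) (hY : IsProjectiveOver Y) (N : Nabla X) (N' : Nabla Y)
    (u : Y ⟶ X) [Surjective u.left] (ν : N'.N ⟶ N.N) (hν : ν ≫ N.incl = N'.incl ≫ (u ⊗ₘ u))
    {κ κ' : Type} {P : κ → SchemeOver ℂ} {P' : κ' → SchemeOver ℂ}
    (inj : ∀ c, P c ⟶ (bcFunctor k ℂ).obj X) [∀ c, GeometricallyIrreducible (P c).hom]
    (hcol : IsColimit (Cofan.mk ((bcFunctor k ℂ).obj X) inj))
    (inj' : ∀ c', P' c' ⟶ (bcFunctor k ℂ).obj Y) [∀ c', GeometricallyIrreducible (P' c').hom]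
    (hcol' : IsColimit (Cofan.mk ((bcFunctor k ℂ).obj Y) inj')) :
    ∀ Pt : AlgPoints N.N ℂ, ∃ Q : AlgPoints N'.N ℂ, Q ≫ ν = Pt := by
  haveI : IsProper X.hom := hX.isProper
  haveI : IsProper Y.hom := hY.isProper
  haveI : UniversallyClosed (u.left ≫ X.hom) := by
    rw [Over.w u]
    infer_instance
  haveI : UniversallyClosed u.left := UniversallyClosed.of_comp_of_isSeparated u.left X.hom
  exact exists_comp_eq_of_surjective (d := d) hX N N' u ν hν inj hcol inj' hcol'

end Complex

end Nabla

/-! ## §3 `Alb_u` is an epimorphism for `u` surjective -/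

namespace Albanese

open AbelianVariety (bcSpec bcFunctor)

set_option backward.isDefEq.respectTransparency false

variable {k : Type} [Field k] [Algebra k ℂ]

/-- **`Alb_u : Alb_Y → Alb_X` is an EPIMORPHISM of abelian varieties for every SURJECTIVE morphism `u : Y → X` of projective
`k`-schemes with `X` smooth** (`k` of characteristic zero, `k ⊆ ℂ`; given colimit cofans of geometrically irreducible complex pieces of
`X_ℂ` and `Y_ℂ`).  This is [Lang1983AbelianVarieties] Ch. II §3 Prop. 7 — «if `φ` is generically surjective then `φ_*` is generically
surjective», `φ_*` the induced homomorphism of Albanese varieties (Prop. 5) — in Liu's normalisation `Alb_u ∘ α_Y = α_X ∘ ∇u` (Def. 2.3,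
l. 1206–1208), for reducible `X`, `Y` and WITHOUT flatness of `u`: `∇u` hits every `ℂ`-point of `∇X` (§2), `∇X` is reduced and locally
of finite type (★ `NablaSmooth`), so ★ `Albanese.epi_map_of_nablaMap_surjective_algPoints` applies.  Compare ★
`Albanese.epi_map_of_surjective` (`AlbaneseTraceIsogeny`), which needs `u` universally open.
[cite: Lang1983AbelianVarieties, Ch. II §3 Prop. 5 (p. 47) and Prop. 7 (p. 48)] [cite: Liu2021, Def. 2.3 (l. 1202–1208) and §4.2 l. 2064–2072] -/
theorem epi_map_of_surjective_of_pieces [CharZero k] {d : ℕ} {X Y : SchemeOver k} [SmoothOfRelativeDimension d X.hom]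
    (hX : IsProjectiveOver X) (hY : IsProjectiveOver Y) (aY : Albanese Y) (aX : Albanese X) (u : Y ⟶ X) [Surjective u.left]
    {κ κ' : Type} {P : κ → SchemeOver ℂ} {P' : κ' → SchemeOver ℂ}
    (inj : ∀ c, P c ⟶ (bcFunctor k ℂ).obj X) [∀ c, GeometricallyIrreducible (P c).hom]
    (hcol : IsColimit (Cofan.mk ((bcFunctor k ℂ).obj X) inj))
    (inj' : ∀ c', P' c' ⟶ (bcFunctor k ℂ).obj Y) [∀ c', GeometricallyIrreducible (P' c').hom]
    (hcol' : IsColimit (Cofan.mk ((bcFunctor k ℂ).obj Y) inj')) :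
    Epi (aY.map aX u) := by
  haveI := Nabla.isReduced_left (d := d) aX.nabla
  haveI := Nabla.locallyOfFiniteType_hom (d := d) aX.nabla
  exact epi_map_of_nablaMap_surjective_algPoints ℂ aY aX u
    (Nabla.exists_comp_eq_of_surjective_of_isProjectiveOver (d := d) hX hY aX.nabla aY.nabla u (aY.nabla.map aX.nabla u)
      (aY.nabla.map_incl aX.nabla u) inj hcol inj' hcol')

end Albanese

/-! ## §4 The transition morphisms of a §4.2 datum: `Alb_{u^{K'}_K}` is an epimorphism as soon as `u^{K'}_K` is surjective -/

namespace Sec42Data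

open AbelianVariety (bcSpec bcFunctor)

set_option backward.isDefEq.respectTransparency false

variable {F E : Type} [Field F] [NumberField F] [NumberField.IsTotallyReal F] [Field E] [NumberField E] [Algebra F E]
  [NumberField.IsTotallyComplex E] [Algebra.IsQuadraticExtension F E]
variable {P5 : PropC5Data F E} {isotropicAt : ℕ → Prop} (C : Sec42Data P5 isotropicAt)

/-- **`Alb_{u^{K'}_K}` is an EPIMORPHISM as soon as the transition morphism `u^{K'}_K : X_{K'} → X_K` is SURJECTIVE** (§4.2 datum `C`,
`E ⊆ ℂ`; given colimit cofans of geometrically irreducible complex pieces of `X_K ⊗_E ℂ` and `X_{K'} ⊗_E ℂ`).  Both levels are smooth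
projective (`CompactifiedSystem.smooth_X ∕ projective_X`, §4.2 l. 2064), so `u^{K'}_K` is universally closed, §1 supplies the same-piece
lifting, and ★ `Sec42Data.epi_Atr_of_pieces_lift` the epimorphism.  Flatness-free form of input (I) of the reduction of Thm. 4.18 (1)
(l. 2064 «generically finite dominant»; [Lang1983AbelianVarieties] II §3 Prop. 7). [cite: Liu2021, §4.2 l. 2060–2072 and Thm. 4.18 (1) proof l. 2247–2282; Def. 2.1 (1), Def. 2.3]
[cite: Lang1983AbelianVarieties, Ch. II §3 Prop. 7 (p. 48)] -/
theorem epi_Atr_of_surjective [Algebra E ℂ] {K K' : C5.SmallLevel C.S.K₀} (f : K' ⟶ K) [Surjective (C.cpt.X.map f).left]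
    {κ κ' : Type} {P : κ → SchemeOver ℂ} {P' : κ' → SchemeOver ℂ}
    (inj : ∀ c, P c ⟶ (bcFunctor E ℂ).obj (C.X K)) [∀ c, GeometricallyIrreducible (P c).hom]
    (hcol : IsColimit (Cofan.mk ((bcFunctor E ℂ).obj (C.X K)) inj))
    (inj' : ∀ c', P' c' ⟶ (bcFunctor E ℂ).obj (C.X K')) [∀ c', GeometricallyIrreducible (P' c').hom]
    (hcol' : IsColimit (Cofan.mk ((bcFunctor E ℂ).obj (C.X K')) inj')) :
    Epi (C.Atr f) := by
  haveI : IsProper (C.X K).hom := (C.cpt.projective_X K).isProper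
  haveI : IsProper (C.X K').hom := (C.cpt.projective_X K').isProper
  haveI : UniversallyClosed ((C.cpt.X.map f).left ≫ (C.X K).hom) := by
    rw [Over.w (C.cpt.X.map f)]
    infer_instance
  haveI : UniversallyClosed (C.cpt.X.map f).left := UniversallyClosed.of_comp_of_isSeparated _ (C.X K).hom
  exact C.epi_Atr_of_pieces_lift f inj hcol inj' (Nabla.pieces_lift_of_surjective (C.cpt.X.map f) inj inj' hcol')

end Sec42Data

end Literature.NumberTheory.Automorphic.Liu2021.AppendixC

end
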